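import Summits.ResolutionOfSingularities.ResolutionOfSingularities.Theorems.FrobeniusClosingSteerFarCleaningDepth
import Summits.ResolutionOfSingularities.ResolutionOfSingularities.Theorems.FrobeniusClosingSteerCore4SteeredRunExists
import HarnessLib

/-!
# Crux `Steer` (stmt-ResolutionOfSingularities-16345), chain W4.1 — §σ2.20 NORMALISED START, piece **(N1)**
# `exists_normalAt_generator`: the radicand generator can be normalised in the FIXED local ring of the base

OURS (campaign `res-hironaka`, rung L, slot W4.1, chain W4.1; replaces the role of no printed item; NOT a
statement of the manuscript under review [claim: Hironaka2017, status: under-review]; AI review is weaker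
than expert review).  Theses-free, definition-free helper for the σ-residual of the line of record
`Cruxes/Steer/Lines/switching_dichotomy.lean` (holder res-L0-w41-lead-1, r24), res-L0-w41-plan-1 RULING 7 (g8)
«§σ2.20 NORMALISED START» piece (N1), in the target shape of res-D-pv-028's `NormalAtGeneratorTwo`
(2026-08-27T08:15:08Z) with res-L0-w41-strat-2's `NormalAt` (delta rev 11) UNFOLDED:

> **(N1).** Let `S := (A₀)_{𝔪_O ∩ A₀} ⊆ K` be the local ring of the base at the centre of `O` — regular,
> essentially of finite type over the perfect field `k` of characteristic `p` — and `t ∈ K` with `t ^ p ∈ A₀`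
> not a `p`-th power in `S`.  Then `t = h · t₁ + g` with `g, h ∈ S`, `t₁ ^ p ∈ S`, and `t₁` NORMAL at `S`:
> `t₁ ^ p ≠ g' ^ p + h' ^ p · u'` for all `g', h', u' ∈ S` with `v(h') > 0`.

## Proof (namespace `…Theorems.SwitchingDichotomy.NormalStart`)

* **START — detection** (`exists_derivation_apply_ne_zero`): in an integrally closed domain `D` essentially of
  finite type over a perfect field of characteristic `p`, an `f ∈ D` that is not a `p`-th power in `D` has
  `∂ f ≠ 0` for some derivation `∂` of `D` (tree P `PBasisDual.exists_derivation_commonKernel` on `Frac D`,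
  denominators and restriction from `FarCleaningDepth`, and `Frac D ∩`‐`p`-th roots lie in `D`).
* **ITERATION** (`exists_normal_of_derivation`, any local Noetherian subring `S ⊆ K`): while
  `t₁ ^ p = g ^ p + h ^ p · u` with `h ∈ 𝔪_S`, replace `t₁ ↦ (t₁ − g) / h` (new radicand `u`).  For EVERY
  derivation `∂` of `S`, `∂ (t₁ ^ p) = h ^ p · ∂ u`; so the JACOBIAN IDEAL `J(f) := (∂ f)_∂` satisfies
  `J(t₁ ^ p) ⊆ h ^ p · J(u) ⊆ J(u)`, and equality would give `J(u) = h ^ p · J(u)`, i.e. `J(u) = 0` by Nakayama —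
  impossible as soon as some `∂ (t₁ ^ p) ≠ 0` (an invariant the same identity propagates, and which also
  forces `h ≠ 0`).  Hence `J` strictly increases: Noetherian induction (`IsNoetherian.induction`) terminates
  the loop at a normal generator.
* **(N1)** (`exists_normalAt_generator`): at `S = locAtCentre A₀.toSubring O` (regular ⇒ integrally closed,
  `isIntegrallyClosed_of_isRegularLocalRing`; `EssFiniteType` over `k` as a localisation of the finitely
  generated `A₀`; «not a `p`-th power» transported from the core datum's row along `locAtCentreEquiv`),
  START + ITERATION, and `h' ∈ 𝔪_S ⟺ v(h') < 1` (`mem_maximalIdeal_locAtCentre_iff`).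

Elementary; no named facts, no definitions, no `sorry`. [cite: Matsumura1987, §26 Thm. 26.5; Thm. 19.4]
[cite: Kunz1969, §1–2 (context: Jacobian ideals and p-th powers)] [folklore]
-/

noncomputable section

-- `Summit.<S>.<S>.…` duplicates the summit name by design (single-problem summit).
set_option linter.dupNamespace false
set_option autoImplicit false

namespace Summit.ResolutionOfSingularities.ResolutionOfSingularities.Theorems.SwitchingDichotomy.NormalStart

open IsLocalRing
open Literature.AlgebraicGeometry.Resolution
open Literature.AlgebraicGeometry.CossartPiltant200819.OrderAtClosedPoint (derivation_apply_pow_char)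
open Summit.ResolutionOfSingularities.ResolutionOfSingularities.Theorems.SwitchingDichotomy
  (FarCleaningDepth.exists_denominator FarCleaningDepth.exists_restrict)

universe u w

/-! ### START: derivations detect non-`p`-th powers in an integrally closed domain essentially of finite
type over a perfect field -/

section Start

variable (k : Type w) {D : Type u} [Field k] [CommRing D] [IsDomain D] [Algebra k D]
  (p : ℕ) [Fact p.Prime] [CharP k p]

/-- **Detection.** In an integrally closed domain `D` essentially of finite type over a perfect field `k` of
characteristic `p`, an element which is not a `p`-th power in `D` is moved by some derivation of `D`:
the dual derivations of a `p`-basis of `Frac D` have common kernel `(Frac D)^p`, they restrict to `D` after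
clearing denominators, and a `p`-th root in `Frac D` of an element of `D` lies in `D`.
[cite: Matsumura1987, §26 Thm. 26.5] [folklore] -/
theorem exists_derivation_apply_ne_zero [PerfectField k] [Algebra.EssFiniteType k D] [IsIntegrallyClosed D]
    {f : D} (hf : ∀ c : D, f ≠ c ^ p) : ∃ θ : Derivation ℤ D D, θ f ≠ 0 := by
  haveI : CharP (FractionRing D) p :=
    charP_of_injective_algebraMap (algebraMap k (FractionRing D)).injective p
  obtain ⟨e, Δ, hΔ⟩ := PBasisDual.exists_derivation_commonKernel k p (F := FractionRing D)
  by_contra hall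
  push Not at hall
  -- every `Δ l` kills `f`: restrict `c_l · Δ l` to `D`
  have hz : ∀ l, Δ l (algebraMap D (FractionRing D) f) = 0 := by
    intro l
    obtain ⟨c, hc0, hc⟩ := FarCleaningDepth.exists_denominator k (D := D) p (Δ l)
    obtain ⟨θ, hθ⟩ := FarCleaningDepth.exists_restrict (Δ l) (IsFractionRing.injective D (FractionRing D)) c hc
    have h1 := hθ f
    rw [hall θ, map_zero] at h1
    rcases mul_eq_zero.mp h1.symm with h | h
    · exact absurd h ((map_ne_zero_iff _ (IsFractionRing.injective D (FractionRing D))).mpr hc0)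
    · exact h
  obtain ⟨y, hy⟩ := (hΔ _).mp hz
  -- `y` is integral over `D` (`y ^ p = f`), hence in `D`
  have hint : IsIntegral D y := by
    refine IsIntegral.of_pow (Fact.out : p.Prime).pos ?_
    rw [hy]
    exact isIntegral_algebraMap
  obtain ⟨c, hc⟩ := IsIntegrallyClosed.isIntegral_iff.mp hint
  refine hf c (IsFractionRing.injective D (FractionRing D) ?_)
  rw [map_pow, hc, hy]

end Start

/-! ### ITERATION: Noetherian induction on the Jacobian ideal -/

section Iteration

variable {K : Type} [Field K] (p : ℕ) [Fact p.Prime] [CharP K p]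

omit [Fact p.Prime] in
/-- For `f = g ^ p + h ^ p · u` in a subring of characteristic `p`, every derivation satisfies
`∂ f = h ^ p · ∂ u`. [folklore] -/
theorem derivation_apply_eq_of_eq_add_pow_mul (S : Subring K) (θ : Derivation ℤ S S) {f g h u : S}
    (hf : f = g ^ p + h ^ p * u) : θ f = h ^ p * θ u := by
  rw [hf, map_add, derivation_apply_pow_char, zero_add, Derivation.leibniz, derivation_apply_pow_char,
    smul_zero, add_zero, smul_eq_mul]

/-- **Iteration.** Let `S ⊆ K` be a local Noetherian subring (characteristic `p`), `t₁ ∈ K` with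
`f = t₁ ^ p ∈ S` and `∂ f ≠ 0` for some derivation `∂` of `S`.  Then `t₁ = h · t₂ + g` with `g, h ∈ S`,
`t₂ ^ p ∈ S` and `t₂` NORMAL: `t₂ ^ p ≠ g' ^ p + h' ^ p · u'` whenever `g', h', u' ∈ S`, `h' ∈ 𝔪_S`.
Proof: Noetherian induction on the Jacobian ideal `(∂ f)_∂`, which strictly increases under
`t₁ ↦ (t₁ − g') / h'` by `∂ f = h' ^ p · ∂ u'` and Nakayama. [cite: Kunz1969, §1–2] [folklore] -/
theorem exists_normal_of_derivation (S : Subring K) [IsLocalRing S] [IsNoetherianRing S]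
    (t₁ : K) (f : S) (hf : (f : K) = t₁ ^ p) (hθ : ∃ θ : Derivation ℤ S S, θ f ≠ 0) :
    ∃ t₂ g h : K, g ∈ S ∧ h ∈ S ∧ t₁ = h * t₂ + g ∧ t₂ ^ p ∈ S ∧
      ∀ g' h' u' : S, h' ∈ maximalIdeal S → t₂ ^ p ≠ (g' : K) ^ p + (h' : K) ^ p * (u' : K) := by
  have hp : p.Prime := Fact.out
  suffices H : ∀ I : Ideal S, ∀ (t₁ : K) (f : S), (f : K) = t₁ ^ p →
      (∃ θ : Derivation ℤ S S, θ f ≠ 0) →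
      Ideal.span (Set.range fun θ : Derivation ℤ S S => θ f) = I →
      ∃ t₂ g h : K, g ∈ S ∧ h ∈ S ∧ t₁ = h * t₂ + g ∧ t₂ ^ p ∈ S ∧
        ∀ g' h' u' : S, h' ∈ maximalIdeal S → t₂ ^ p ≠ (g' : K) ^ p + (h' : K) ^ p * (u' : K) from
    H _ t₁ f hf hθ rfl
  intro I
  induction I using IsNoetherian.induction with
  | hgt I ih =>
    intro t₁ f hf hθ hI
    by_cases hN : ∀ g' h' u' : S, h' ∈ maximalIdeal S → t₁ ^ p ≠ (g' : K) ^ p + (h' : K) ^ p * (u' : K)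
    · exact ⟨t₁, 0, 1, S.zero_mem, S.one_mem, by ring, hf ▸ f.2, hN⟩
    push Not at hN
    obtain ⟨g', h', u', hh', heq⟩ := hN
    -- the decomposition inside `S`
    have hfS : f = g' ^ p + h' ^ p * u' := Subtype.ext (by rw [hf, heq]; push_cast; ring)
    have key : ∀ θ : Derivation ℤ S S, θ f = h' ^ p * θ u' :=
      fun θ => derivation_apply_eq_of_eq_add_pow_mul p S θ hfS
    obtain ⟨θ₀, hθ₀⟩ := hθ
    have hθu : θ₀ u' ≠ 0 := fun h0 => hθ₀ (by rw [key, h0, mul_zero])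
    have hh0 : (h' : K) ≠ 0 := by
      intro h0
      apply hθ₀
      have : h' = 0 := Subtype.ext h0
      rw [key, this, zero_pow hp.ne_zero, zero_mul]
    -- Jacobian ideals: `J(f) ≤ (h'^p) · J(u') < J(u')`
    have hle : Ideal.span (Set.range fun θ : Derivation ℤ S S => θ f) ≤
        Ideal.span {h' ^ p} * Ideal.span (Set.range fun θ : Derivation ℤ S S => θ u') := by
      refine Ideal.span_le.mpr ?_
      rintro _ ⟨θ, rfl⟩
      change θ f ∈ _
      rw [key θ]
      exact Ideal.mul_mem_mul (Ideal.mem_span_singleton_self _) (Ideal.subset_span ⟨θ, rfl⟩)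
    have hlt : I < Ideal.span (Set.range fun θ : Derivation ℤ S S => θ u') := by
      rw [← hI]
      refine lt_of_le_of_ne (hle.trans Ideal.mul_le_left) fun hJ => ?_
      have hbot : Ideal.span (Set.range fun θ : Derivation ℤ S S => θ u') = ⊥ := by
        refine Submodule.eq_bot_of_le_smul_of_le_jacobson_bot (Ideal.span {h' ^ p}) _
          (IsNoetherian.noetherian _) ?_ ?_
        · rw [Ideal.smul_eq_mul]
          calc Ideal.span (Set.range fun θ : Derivation ℤ S S => θ u')
              = Ideal.span (Set.range fun θ : Derivation ℤ S S => θ f) := hJ.symm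
            _ ≤ _ := hle
        · exact le_trans ((Ideal.span_singleton_le_iff_mem _).mpr
            (Ideal.pow_mem_of_mem _ hh' p hp.pos)) (IsLocalRing.maximalIdeal_le_jacobson _)
      apply hθu
      have hmem : θ₀ u' ∈ Ideal.span (Set.range fun θ : Derivation ℤ S S => θ u') :=
        Ideal.subset_span ⟨θ₀, rfl⟩
      rw [hbot] at hmem
      exact (Submodule.mem_bot S).mp hmem
    -- recurse on `t₂ := (t₁ - g') / h'`, radicand `u'`
    have ht₂p : ((u' : S) : K) = ((t₁ - g') / h') ^ p := by
      have hhp : (h' : K) ^ p ≠ 0 := pow_ne_zero _ hh0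
      rw [div_pow, sub_pow_char, ← hf, hfS]
      push_cast
      field_simp
      ring
    obtain ⟨t₃, g₃, h₃, hg₃, hh₃, ht₂, ht₃p, hN₃⟩ := ih _ hlt ((t₁ - g') / h') u' ht₂p ⟨θ₀, hθu⟩ rfl
    refine ⟨t₃, (h' : K) * g₃ + g', (h' : K) * h₃, add_mem (mul_mem h'.2 hg₃) g'.2, mul_mem h'.2 hh₃,
      ?_, ht₃p, hN₃⟩
    have ht₁ : t₁ = (h' : K) * ((t₁ - g') / h') + g' := by
      rw [mul_div_cancel₀ _ hh0, sub_add_cancel]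
    rw [ht₁, ht₂]
    ring

end Iteration

/-! ### (N1) at the local ring of the base at the centre of `O` -/

section LocAtCentre

variable {k K : Type} [Field k] [Field K] [Algebra k K]

/-- **(N1) · `exists_normalAt_generator`** (res-L0-w41-plan-1 RULING 7 (g8), §σ2.20 NORMALISED START; target
shape = res-D-pv-028's `NormalAtGeneratorTwo` with res-L0-w41-strat-2's `NormalAt O R p t :=
∀ g h u : K, g ∈ R → h ∈ R → u ∈ R → O.valuation h < 1 → t ^ p ≠ g ^ p + h ^ p * u` UNFOLDED, for EVERY prime
`p`, core-datum rows unbundled: `A₀` finitely generated, `t ^ p ∈ A₀`, the base REGULAR at the centre of `O`,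
`t ^ p` NOT a `p`-th power there, `k` PERFECT).  In the fixed ring `S = (A₀)_{𝔪_O ∩ A₀}`:
`t = h · t₁ + g`, `g, h ∈ S`, `t₁ ^ p ∈ S`, `NormalAt O S p t₁`. [cite: Matsumura1987, §26 Thm. 26.5; Thm. 19.4]
[cite: Kunz1969, §1–2] [folklore] -/
theorem exists_normalAt_generator (p : ℕ) (hp : p.Prime) [CharP k p] [PerfectField k]
    (O : ValuationSubring K) (A₀ : Subalgebra k K) (h₀ : A₀.toSubring ≤ O.toSubring) (t : K)
    (hfg : A₀.FG) (htp : t ^ p ∈ A₀)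
    (hreg : IsRegularLocalRing (Localization.AtPrime
      (Ideal.comap (Subring.inclusion h₀) (IsLocalRing.maximalIdeal O))))
    (hc : ∀ c : Localization.AtPrime (Ideal.comap (Subring.inclusion h₀) (IsLocalRing.maximalIdeal O)),
      algebraMap A₀.toSubring (Localization.AtPrime (Ideal.comap (Subring.inclusion h₀)
        (IsLocalRing.maximalIdeal O))) ⟨t ^ p, htp⟩ ≠ c ^ p) :
    ∃ t₁ g h : K, g ∈ locAtCentre A₀.toSubring O ∧ h ∈ locAtCentre A₀.toSubring O ∧
      t = h * t₁ + g ∧ t₁ ^ p ∈ locAtCentre A₀.toSubring O ∧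
      ∀ g' h' u' : K, g' ∈ locAtCentre A₀.toSubring O → h' ∈ locAtCentre A₀.toSubring O →
        u' ∈ locAtCentre A₀.toSubring O → O.valuation h' < 1 → t₁ ^ p ≠ g' ^ p + h' ^ p * u' := by
  classical
  haveI : Fact p.Prime := ⟨hp⟩
  haveI : CharP K p := charP_of_injective_algebraMap (algebraMap k K).injective p
  haveI hloc : IsLocalRing (locAtCentre A₀.toSubring O) := isLocalRing_locAtCentre h₀
  haveI hregS : IsRegularLocalRing (locAtCentre A₀.toSubring O) :=
    (isRegularLocalRing_locAtCentre_iff h₀).mpr hreg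
  haveI : IsIntegrallyClosed (locAtCentre A₀.toSubring O) :=
    isIntegrallyClosed_of_isRegularLocalRing (locAtCentre A₀.toSubring O)
  -- `S` is essentially of finite type over `k`
  letI algA : Algebra k A₀.toSubring := A₀.algebra
  haveI : Algebra.FiniteType k A₀.toSubring := (Subalgebra.fg_iff_finiteType A₀).mp hfg
  letI algS : Algebra k (locAtCentre A₀.toSubring O) :=
    ((algebraMap A₀.toSubring (locAtCentre A₀.toSubring O)).comp (algebraMap k A₀.toSubring)).toAlgebra
  haveI : IsScalarTower k A₀.toSubring (locAtCentre A₀.toSubring O) :=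
    IsScalarTower.of_algebraMap_eq fun _ => rfl
  haveI := isLocalization_locAtCentre (B := A₀.toSubring) (O := O) h₀
  haveI : Algebra.EssFiniteType A₀.toSubring (locAtCentre A₀.toSubring O) :=
    Algebra.EssFiniteType.of_isLocalization (locAtCentre A₀.toSubring O)
      (subringCentre A₀.toSubring O h₀).primeCompl
  haveI : Algebra.EssFiniteType k (locAtCentre A₀.toSubring O) :=
    Algebra.EssFiniteType.comp k A₀.toSubring (locAtCentre A₀.toSubring O)
  -- the radicand in `S`; it is not a `p`-th power there
  set f : locAtCentre A₀.toSubring O := ⟨t ^ p, le_locAtCentre _ O htp⟩ with hfdef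
  have hfK : (f : K) = t ^ p := rfl
  have hfc : ∀ c : locAtCentre A₀.toSubring O, f ≠ c ^ p := by
    intro c hfc
    have e := locAtCentreEquiv (B := A₀.toSubring) (O := O) h₀
    have h1 : algebraMap A₀.toSubring (locAtCentre A₀.toSubring O) ⟨t ^ p, htp⟩ = c ^ p := by
      rw [← hfc]
      exact Subtype.ext (locAtCentre.algebraMap_apply _ _ _)
    have h2 : algebraMap A₀.toSubring (Localization.AtPrime (subringCentre A₀.toSubring O h₀))
        ⟨t ^ p, htp⟩ = (e.symm c) ^ p := by
      rw [← map_pow, ← h1]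
      exact (e.symm.commutes _).symm
    exact hc _ h2
  -- START + ITERATION
  obtain ⟨θ, hθ⟩ := exists_derivation_apply_ne_zero k p hfc
  obtain ⟨t₁, g, h, hg, hh, ht, ht₁p, hN⟩ :=
    exists_normal_of_derivation p (locAtCentre A₀.toSubring O) t f hfK ⟨θ, hθ⟩
  refine ⟨t₁, g, h, hg, hh, ht, ht₁p, fun g' h' u' hg' hh' hu' hv => ?_⟩
  exact hN ⟨g', hg'⟩ ⟨h', hh'⟩ ⟨u', hu'⟩ ((mem_maximalIdeal_locAtCentre_iff h₀ _).mpr hv)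

end LocAtCentre

end Summit.ResolutionOfSingularities.ResolutionOfSingularities.Theorems.SwitchingDichotomy.NormalStart
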